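import Mathlib.RingTheory.DiscreteValuationRing.Basic
import Mathlib.RingTheory.PowerSeries.Trunc
import Mathlib.Algebra.Polynomial.Div
import HarnessLib

/-!
# Barrier (Schanuel) `NesterenkoModularScope`: expansion of a discrete valuation ring with coefficient field into `K⟦t⟧` — proofs only

`Literature/Barriers/Schanuel/NesterenkoModularScopePlaceExpansion.lean` — proofs-only groundwork
(no definitions, nothing asserted) for LNM 1752 Ch. 10 Proposition 5.1 (named fact
`NesterenkoPhilippon2001_ch10_prop_5_1`): the "parametrization of a branch at `x = 1`" used in
the printed proof of Lemma 5.3 (p. 163: "there exists a natural number `e` and a parametrization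
`x = 1 + tᵉ, u = Σ aₖtᵏ, v = Σ bₖtᵏ`") is obtained, for the function field of the curve `V(𝔮)`
and a place centred at the point `(1, 1, 1)`, from the following general statement proved here:

* `exists_algHom_powerSeries_of_residue` — **a discrete valuation ring `O` which is a `K`-algebra
  with `K → O/𝔪` surjective (a "rational" place) embeds `K`-linearly and multiplicatively into
  `K⟦t⟧`, injectively, with `𝔪 ↦ (t)`**: every `f ∈ O` has, for a uniformizer `π`, unique
  expansions `f = Σ_{k<n} c_k πᵏ + πⁿ g` (`expansion_unique`), and `f ↦ Σ c_k tᵏ` is the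
  embedding (Stichtenoth, *Algebraic Function Fields and Codes*, Thm. 4.2.6 (the `P`-adic power
  series expansion at a place of degree one); here for an abstract DVR).

## References

* [NesterenkoPhilippon2001] LNM 1752, Ch. 10 §5, proof of Lemma 5.3 (p. 163).
* [Stichtenoth2009] H. Stichtenoth, *Algebraic Function Fields and Codes*, GTM 254, Thm. 4.2.6.
-/

noncomputable section

open PowerSeries IsLocalRing

namespace Literature.Barriers.Schanuel

variable {K O : Type*} [Field K] [CommRing O] [IsDomain O] [IsDiscreteValuationRing O]
  [Algebra K O]

omit [IsDiscreteValuationRing O] in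
/-- **Uniqueness of `π`-adic expansions**: if `Σ_{k<n} b_k πᵏ ∈ πⁿO` with `b_k ∈ K` then all
`b_k = 0`. [cite: Stichtenoth2009, Thm. 4.2.6] -/
theorem expansion_unique {π : O} (hπ : Irreducible π) :
    ∀ (n : ℕ) (b : ℕ → K) (g : O),
      ∑ k ∈ Finset.range n, algebraMap K O (b k) * π ^ k = π ^ n * g → ∀ k < n, b k = 0 := by
  intro n
  induction n with
  | zero => intro b g _ k hk; omega
  | succ n ih =>
    intro b g h k hk
    rw [Finset.sum_range_succ'] at h
    simp only [pow_zero, mul_one] at h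
    have hb0 : b 0 = 0 := by
      by_contra hne
      have hunit : IsUnit (algebraMap K O (b 0)) := (IsUnit.mk0 _ hne).map _
      have hdvd : π ∣ algebraMap K O (b 0) := by
        refine ⟨π ^ n * g - ∑ k ∈ Finset.range n, algebraMap K O (b (k + 1)) * π ^ k, ?_⟩
        have e : algebraMap K O (b 0) =
            π ^ (n + 1) * g - ∑ k ∈ Finset.range n, algebraMap K O (b (k + 1)) * π ^ (k + 1) := by
          rw [← h]; ring
        rw [e, mul_sub, Finset.mul_sum, pow_succ']
        congr 1
        · ring
        · exact Finset.sum_congr rfl fun k _ => by ring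
      exact hπ.not_isUnit (isUnit_of_dvd_unit hdvd hunit)
    rcases Nat.eq_zero_or_pos k with rfl | hkpos
    · exact hb0
    · obtain ⟨j, rfl⟩ := Nat.exists_eq_add_one_of_ne_zero hkpos.ne'
      refine ih (fun i => b (i + 1)) g ?_ j (by omega)
      apply mul_left_cancel₀ hπ.ne_zero
      rw [hb0, map_zero, add_zero] at h
      rw [Finset.mul_sum, show π * (π ^ n * g) = π ^ (n + 1) * g by ring, ← h]
      exact Finset.sum_congr rfl fun i _ => by ring

/-- **Existence of `π`-adic expansions** when `K → O/𝔪` is onto: `f = Σ_{k<n} b_k πᵏ + πⁿ g`.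
[cite: Stichtenoth2009, Thm. 4.2.6] -/
theorem expansion_exists (hres : ∀ f : O, ∃ c : K, f - algebraMap K O c ∈ maximalIdeal O)
    {π : O} (hπ : Irreducible π) (f : O) (n : ℕ) :
    ∃ bg : (ℕ → K) × O,
      f = ∑ k ∈ Finset.range n, algebraMap K O (bg.1 k) * π ^ k + π ^ n * bg.2 := by
  induction n with
  | zero => exact ⟨(0, f), by simp⟩
  | succ n ih =>
    obtain ⟨⟨b, g⟩, hfg⟩ := ih
    obtain ⟨c, hc⟩ := hres g
    rw [hπ.maximalIdeal_eq, Ideal.mem_span_singleton] at hc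
    obtain ⟨g', hg'⟩ := hc
    refine ⟨(Function.update b n c, g'), ?_⟩
    dsimp only
    rw [Finset.sum_range_succ, Function.update_self,
      Finset.sum_congr rfl fun k hk => by
        rw [Function.update_of_ne (Finset.mem_range.mp hk).ne]]
    have hg : g = algebraMap K O c + π * g' := by rw [← hg']; ring
    rw [hfg, hg]
    ring

/-- A truncation written as a sum of monomials. [folklore] -/
theorem trunc_eq_sum_monomial (n : ℕ) (φ : K⟦X⟧) :
    trunc n φ = ∑ k ∈ Finset.range n, Polynomial.monomial k (coeff k φ) := by
  ext d
  rw [coeff_trunc, Polynomial.finsetSum_coeff]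
  simp only [Polynomial.coeff_monomial, Finset.sum_ite_eq', Finset.mem_range]

omit [IsDomain O] [IsDiscreteValuationRing O] in
/-- `aeval π (trunc n φ) = Σ_{k<n} (coeff k φ) πᵏ`. [folklore] -/
theorem aeval_trunc_eq_sum (π : O) (n : ℕ) (φ : K⟦X⟧) :
    Polynomial.aeval π (trunc n φ) =
      ∑ k ∈ Finset.range n, algebraMap K O (coeff k φ) * π ^ k := by
  rw [trunc_eq_sum_monomial, map_sum]
  exact Finset.sum_congr rfl fun k _ => by rw [Polynomial.aeval_monomial]

/-- The product of two truncations agrees with the truncation of the product up to `Xⁿ`.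
[folklore] -/
theorem exists_trunc_mul_trunc_eq (n : ℕ) (φ ψ : K⟦X⟧) :
    ∃ r : Polynomial K, trunc n φ * trunc n ψ = trunc n (φ * ψ) + Polynomial.X ^ n * r := by
  have hdvd : Polynomial.X ^ n ∣ trunc n φ * trunc n ψ - trunc n (φ * ψ) := by
    rw [Polynomial.X_pow_dvd_iff]
    intro d hd
    have h := congrArg (fun p : Polynomial K => p.coeff d) (trunc_trunc_mul_trunc (n := n) φ ψ)
    simp only [coeff_trunc, if_pos hd] at h
    rw [Polynomial.coeff_sub, coeff_trunc, if_pos hd, ← h, ← Polynomial.coeff_coe,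
      Polynomial.coe_mul, sub_self]
  obtain ⟨r, hr⟩ := hdvd
  exact ⟨r, by rw [← hr]; ring⟩

/-- **Expansion map of a discrete valuation ring with coefficient field.** Let `O` be a discrete
valuation ring and a `K`-algebra such that every element of `O` is congruent to a constant modulo
the maximal ideal (`K → O/𝔪` onto; e.g. the valuation ring of a place of degree one of a function
field `F/K`). Then there is an injective `K`-algebra homomorphism `ι : O → K⟦t⟧` mapping the
maximal ideal into `(t)` (the `π`-adic expansion with respect to a uniformizer `π`).
[cite: Stichtenoth2009, Thm. 4.2.6] [cite: NesterenkoPhilippon2001, Ch. 10 §5, proof of Lemma 5.3 (p. 163)] -/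
theorem exists_algHom_powerSeries_of_residue
    (hres : ∀ f : O, ∃ c : K, f - algebraMap K O c ∈ maximalIdeal O) :
    ∃ ι : O →ₐ[K] K⟦X⟧, Function.Injective ι ∧
      ∀ f : O, f ∈ maximalIdeal O → constantCoeff (ι f) = 0 := by
  obtain ⟨π, hπ⟩ := IsDiscreteValuationRing.exists_irreducible O
  choose bg hbg using expansion_exists hres hπ
  -- coherence of the expansions of different lengths
  have hcoh : ∀ (f : O) (m n : ℕ), m ≤ n → ∀ i < m, (bg f n).1 i = (bg f m).1 i := by
    intro f m n hmn i hi
    obtain ⟨j, rfl⟩ := Nat.exists_eq_add_of_le hmn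
    have hn := hbg f (m + j)
    have hm := hbg f m
    rw [Finset.sum_range_add] at hn
    have key : ∑ k ∈ Finset.range m, algebraMap K O ((bg f (m + j)).1 k - (bg f m).1 k) * π ^ k =
        π ^ m * ((bg f m).2 - (∑ k ∈ Finset.range j, algebraMap K O ((bg f (m + j)).1 (m + k)) * π ^ k
          + π ^ j * (bg f (m + j)).2)) := by
      have e : ∑ k ∈ Finset.range m, algebraMap K O ((bg f (m + j)).1 k - (bg f m).1 k) * π ^ k =
          ∑ k ∈ Finset.range m, algebraMap K O ((bg f (m + j)).1 k) * π ^ k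
            - ∑ k ∈ Finset.range m, algebraMap K O ((bg f m).1 k) * π ^ k := by
        rw [← Finset.sum_sub_distrib]
        exact Finset.sum_congr rfl fun k _ => by rw [map_sub]; ring
      have e2 : ∑ k ∈ Finset.range j, algebraMap K O ((bg f (m + j)).1 (m + k)) * π ^ (m + k) =
          π ^ m * ∑ k ∈ Finset.range j, algebraMap K O ((bg f (m + j)).1 (m + k)) * π ^ k := by
        rw [Finset.mul_sum]
        exact Finset.sum_congr rfl fun k _ => by ring
      rw [e2] at hn
      rw [e]
      linear_combination hm - hn
    have := expansion_unique hπ m _ _ key i hi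
    exact sub_eq_zero.mp this
  -- the coefficient functional and the expansions of every length
  set cf : O → ℕ → K := fun f k => (bg f (k + 1)).1 k with hcf
  have hexp : ∀ (f : O) (n : ℕ),
      f = ∑ k ∈ Finset.range n, algebraMap K O (cf f k) * π ^ k + π ^ n * (bg f n).2 := by
    intro f n
    conv_lhs => rw [hbg f n]
    congr 1
    exact Finset.sum_congr rfl fun k hk => by
      rw [hcoh f (k + 1) n (Finset.mem_range.mp hk) k (Nat.lt_succ_self k)]
  -- characterisation of the expansion
  have hchar : ∀ (f : O) (φ : K⟦X⟧),
      (∀ n, ∃ g : O, f = ∑ k ∈ Finset.range n, algebraMap K O (coeff k φ) * π ^ k + π ^ n * g) →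
      φ = PowerSeries.mk (cf f) := by
    intro f φ h
    ext k
    rw [coeff_mk]
    obtain ⟨g, hg⟩ := h (k + 1)
    have hf := hexp f (k + 1)
    have key : ∑ i ∈ Finset.range (k + 1), algebraMap K O (coeff i φ - cf f i) * π ^ i =
        π ^ (k + 1) * ((bg f (k + 1)).2 - g) := by
      have e : ∑ i ∈ Finset.range (k + 1), algebraMap K O (coeff i φ - cf f i) * π ^ i =
          ∑ i ∈ Finset.range (k + 1), algebraMap K O (coeff i φ) * π ^ i
            - ∑ i ∈ Finset.range (k + 1), algebraMap K O (cf f i) * π ^ i := by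
        rw [← Finset.sum_sub_distrib]
        exact Finset.sum_congr rfl fun i _ => by rw [map_sub]; ring
      rw [e]
      linear_combination hf - hg
    exact sub_eq_zero.mp (expansion_unique hπ (k + 1) _ _ key k (Nat.lt_succ_self k))
  -- the map
  have hsum : ∀ (f : O) (n : ℕ), ∑ k ∈ Finset.range n, algebraMap K O (cf f k) * π ^ k =
      ∑ k ∈ Finset.range n, algebraMap K O (coeff k (PowerSeries.mk (cf f))) * π ^ k :=
    fun f n => Finset.sum_congr rfl fun k _ => by rw [coeff_mk]
  have hadd : ∀ f f' : O, PowerSeries.mk (cf (f + f')) = PowerSeries.mk (cf f) + PowerSeries.mk (cf f') := by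
    intro f f'
    refine (hchar (f + f') _ fun n => ⟨(bg f n).2 + (bg f' n).2, ?_⟩).symm
    conv_lhs => rw [hexp f n, hexp f' n]
    simp only [map_add, coeff_mk, add_mul, Finset.sum_add_distrib]
    ring
  have hmul : ∀ f f' : O, PowerSeries.mk (cf (f * f')) = PowerSeries.mk (cf f) * PowerSeries.mk (cf f') := by
    intro f f'
    symm
    apply hchar (f * f')
    intro n
    obtain ⟨r, hr⟩ := exists_trunc_mul_trunc_eq n (PowerSeries.mk (cf f)) (PowerSeries.mk (cf f'))
    refine ⟨Polynomial.aeval π r + (∑ k ∈ Finset.range n, algebraMap K O (cf f k) * π ^ k) * (bg f' n).2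
      + (bg f n).2 * (∑ k ∈ Finset.range n, algebraMap K O (cf f' k) * π ^ k)
      + π ^ n * ((bg f n).2 * (bg f' n).2), ?_⟩
    have hprod : (∑ k ∈ Finset.range n, algebraMap K O (cf f k) * π ^ k) *
        (∑ k ∈ Finset.range n, algebraMap K O (cf f' k) * π ^ k) =
        ∑ k ∈ Finset.range n, algebraMap K O (coeff k (PowerSeries.mk (cf f) * PowerSeries.mk (cf f'))) * π ^ k
          + π ^ n * Polynomial.aeval π r := by
      rw [hsum f n, hsum f' n, ← aeval_trunc_eq_sum, ← aeval_trunc_eq_sum, ← aeval_trunc_eq_sum,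
        ← map_mul (Polynomial.aeval π), hr]
      simp only [map_add, map_mul, map_pow, Polynomial.aeval_X]
    conv_lhs => rw [hexp f n, hexp f' n]
    linear_combination hprod
  have hC : ∀ c : K, PowerSeries.mk (cf (algebraMap K O c)) = C c := by
    intro c
    refine (hchar _ _ fun n => ?_).symm
    cases n with
    | zero => exact ⟨algebraMap K O c, by simp⟩
    | succ n =>
      refine ⟨0, ?_⟩
      rw [Finset.sum_eq_single 0 (fun k _ hk => by rw [coeff_C, if_neg hk, map_zero, zero_mul])
        (fun h => absurd (Finset.mem_range.mpr (Nat.succ_pos n)) h)]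
      simp
  let ι : O →ₐ[K] K⟦X⟧ :=
    { toFun := fun f => PowerSeries.mk (cf f)
      map_one' := by
        have h := hC 1
        rwa [map_one, map_one] at h
      map_mul' := hmul
      map_zero' := by
        have h := hC 0
        rwa [map_zero, map_zero] at h
      map_add' := hadd
      commutes' := hC }
  have hιapply : ∀ f, ι f = PowerSeries.mk (cf f) := fun f => rfl
  -- the maximal ideal goes to `(t)`
  have hmax : ∀ f : O, f ∈ maximalIdeal O → constantCoeff (ι f) = 0 := by
    intro f hf
    rw [hπ.maximalIdeal_eq, Ideal.mem_span_singleton] at hf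
    obtain ⟨g, hg⟩ := hf
    rw [hιapply, ← coeff_zero_eq_constantCoeff_apply, coeff_mk]
    have hf1 := hexp f 1
    rw [Finset.sum_range_one, pow_zero, mul_one, pow_one] at hf1
    have key : ∑ k ∈ Finset.range 1, algebraMap K O (cf f k) * π ^ k = π ^ 1 * (g - (bg f 1).2) := by
      rw [Finset.sum_range_one, pow_zero, mul_one, pow_one]
      linear_combination hg - hf1
    exact expansion_unique hπ 1 _ _ key 0 Nat.one_pos
  -- injectivity
  have hne : ∀ f : O, f ≠ 0 → ι f ≠ 0 := by
    intro f hf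
    obtain ⟨m, u, hfu⟩ := IsDiscreteValuationRing.eq_unit_mul_pow_irreducible hf hπ
    obtain ⟨c, hc⟩ := hres u
    have hc0 : c ≠ 0 := by
      rintro rfl
      rw [map_zero, sub_zero] at hc
      exact (IsLocalRing.mem_maximalIdeal _).mp hc u.isUnit
    rw [hπ.maximalIdeal_eq, Ideal.mem_span_singleton] at hc
    obtain ⟨g, hg⟩ := hc
    intro h0
    have hcf0 : cf f m = 0 := by
      have := congrArg (coeff m) h0
      rwa [hιapply, coeff_mk, map_zero] at this
    -- `f = c π^m + π^(m+1) g`: compare with the expansion of length `m + 1`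
    have hfexp : f = ∑ k ∈ Finset.range (m + 1),
        algebraMap K O (Function.update (0 : ℕ → K) m c k) * π ^ k + π ^ (m + 1) * g := by
      rw [Finset.sum_range_succ, Function.update_self,
        Finset.sum_congr rfl fun k hk => by
          rw [Function.update_of_ne (Finset.mem_range.mp hk).ne]]
      simp only [Pi.zero_apply, map_zero, zero_mul, Finset.sum_const_zero, zero_add]
      have hu : (u : O) = algebraMap K O c + π * g := by rw [← hg]; ring
      rw [hfu, hu]
      ring
    have hf' := hexp f (m + 1)
    have key : ∑ k ∈ Finset.range (m + 1),
        algebraMap K O (Function.update (0 : ℕ → K) m c k - cf f k) * π ^ k =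
        π ^ (m + 1) * ((bg f (m + 1)).2 - g) := by
      have e : ∑ k ∈ Finset.range (m + 1),
          algebraMap K O (Function.update (0 : ℕ → K) m c k - cf f k) * π ^ k =
          ∑ k ∈ Finset.range (m + 1), algebraMap K O (Function.update (0 : ℕ → K) m c k) * π ^ k
            - ∑ k ∈ Finset.range (m + 1), algebraMap K O (cf f k) * π ^ k := by
        rw [← Finset.sum_sub_distrib]
        exact Finset.sum_congr rfl fun k _ => by rw [map_sub]; ring
      rw [e]
      linear_combination hf' - hfexp
    have := expansion_unique hπ (m + 1) _ _ key m (Nat.lt_succ_self m)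
    rw [Function.update_self, hcf0, sub_zero] at this
    exact hc0 this
  refine ⟨ι, ?_, hmax⟩
  intro f f' hff'
  by_contra hne'
  exact hne (f - f') (sub_ne_zero.mpr hne') (by rw [map_sub, hff', sub_self])

end Literature.Barriers.Schanuel

end
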